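import Mathlib
import Literature.MathematicalPhysics.QuantumFieldTheory.Balaban1983to89.B7Prop1Local

/-!
# Beta / ThinLoopHolonomy — THE THIN LOOP OF A BOND THROUGH THE TREE CONTOURS (B5 (1.7) ∕ B7 pp. 24–25 ∕ B9 (3.19)):
# `V(Γ_{y,x}) V(x, x+e_μ) V(Γ_{y,x+e_μ})⁻¹` = the bond variable in the complete axial gauge based at `y`; its deviation
# from `1` is GAUGE INVARIANT, LOCAL, and SMALL in two currencies — (P) ≤ `|x − y|₁·α` from the plaquette bound
# `|V(∂p) − 1| ≤ α` INSIDE any box containing `y, x, x + e_μ` (b07's non-abelian Stokes ladder BY NAME), and (G) ≤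
# `(|x − y|₁ + 1 + |x + e_μ − y|₁)·ε` from a (3.35)-SHAPE hypothesis «some gauge on the box makes every bond variable
# ε-close to 1» — NOTE-I3 §5.2 (e2)'s «ONE geometric statement about thin loops + (3.35)» at MODEL level
# (unit `b2b-balaban-beta-d4-p2`, GEN 6, MODEL crew; claim «E-I3-COV-MODEL» journal l.15376)

HONEST FRAMING: discharging `BetaPertH` makes Bałaban's UV stability UNCONDITIONAL — NOT the continuum limit, NOT the
Clay problem.  HONEST DEPENDENCY (verbatim): «continuum YM on T⁴ ⇐ BetaPertH ∧ nine spine estimates (0/9 proved);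
BetaPertH ⇐ (D1) ∧ (D4) ∧ CAP+tail; G-an2-4 gates asym, D1 and NE2/3/4.»  THIS MODULE DISCHARGES NOTHING of `BetaPertH`,
asserts NOTHING printed and cites nothing as a fact (ABSOLUTE RULE): [folklore] group∕normed-ring algebra about MODEL
OBJECTS on `ℤ^d` (b07's words, transports, tree contours, axial gauge, clamped extensions — `B7Prop1Explicit`,
`B7Prop1Local` imported BY NAME, nothing edited; nothing of Bałaban's operators instantiated; which configuration, which
gauge, which `α`∕`ε` — (3.35) + B7 (52)–(53) — is NODE O.2's business).  SHAPES located at [B9] =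
`Balaban1985BackgroundPropagators` (3.19) p. 393 (contour variables `U(Γ^{(j)}_{y,x})`) and (3.35) p. 396 («there exists a
gauge transformation u on □ such that Uᵘ = e^{iηA} … |A| < O(1)Mα₀(L^jη)^{−1}»), [B7] = `Balaban1985Averaging` pp. 24–25
(axial gauge, «|V₀,b − 1| < |b₋ − y|α₀»), [B5] = `Balaban1984PropagatorsI` (1.7) p. 18 (tree contours).  No class change
on row D4 or G-B9-15 (width 0; D4 DISCHARGE NO DATE); NOT BetaPertH, NOT continuum, NOT Clay, NOT summit progress.

WHY (row D4, interface item (I3), E-I3 for a general background).  The owner's NOTE-I3 v1.1 §5.2 splits the energy of a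
covariant bump on a bond into (e1) slope × isometry and (e2) plateau × (thin-loop holonomy − 1), and reduces G-B9-15's
«by analogy» to ONE geometric statement: thin loops between neighbouring contour endpoints are small under (3.35).  This
file is that statement for the MODEL contours (B5 (1.7) trees = pv21's lexicographic combs), in the two forms a consumer
may hold: plaquettes (gauge-invariant data) or a small gauge on the block ((3.35) as printed).  Consumer: this unit's
`Beta/CovariantPlateauBlocks*` (coarse coercivity of `Q̃_U A_U⁻¹ Q̃_Uᵀ` for every transport field); the owner's abstract
`CoarseCoerciveCovariantEnergy` takes the same number `h` as its only field input.

CONTENT (all kernel, 0 sorry).  §1 `thinLoop V y x μ := gaugeAct (axialFn V y) V x μ` (b07's axial-gauge bond variable),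
`thinLoop_eq` (= `V(Γ_{y,x})·V(x,μ)·V(Γ_{y,x+e_μ})⁻¹`), the closed word `thinWord` with `hol_thinWord`, `disp_thinWord = 0`,
`length_thinWord`; GAUGE COVARIANCE `thinLoop_gaugeAct` (conjugation by `u(y)`); LOCALITY `thinLoop_congr` (bonds of a box
containing `y, x, x+e_μ`).  §2 normed units: `norm_thinLoop_gaugeAct_sub_one` (the defect is gauge INVARIANT),
`norm_hol_sub_one_le_length_mul` (‖V(Γ) − 1‖ ≤ |Γ|·ε when every bond variable is ε-close to 1), the clamped extension's
bond variables (`clampCfg_apply_cases`, `norm_clampCfg_sub_one_le`).  §3 (P) **`norm_thinLoop_sub_one_le_of_plaquettes`**: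
‖thin loop − 1‖ ≤ |x − y|₁·α from the plaquettes INSIDE the box (b07 `axial_bond_bound` on `clampCfg`).  §4 (G)
**`norm_thinLoop_sub_one_le_of_gauge`**: ≤ (|x − y|₁ + 1 + |x + e_μ − y|₁)·ε from a gauge `u` on the box with
‖Vᵘ(b) − 1‖ ≤ ε on the box's bonds.  §5 the currency of the consumer: change of structure group (`hol_map`, `thinLoop_map`);
complexified real ORTHOGONAL matrices in the C⋆-algebra `Matrix Cp Cp ℂ` (ℓ²-operator norm) are norm-≤-1 units (`cpxUnit`,
`cpxUnit_mem_U1`); norm bounds ⇔ operator bounds on fibre vectors (`norm_toLp_mulVec_le`, `norm_le_of_mulVec_le`).  §6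
non-vacuity.  PRIOR ART (searched 2026-08-20, `lean search 'axial_bond|thinLoop|holonom|ladder_bound|clampCfg'`): the
ladder and the axial gauge are b07's (`B7Prop1Explicit.axial_bond_bound`, `B7Prop1Local.clampCfg`) — USED, not re-proved;
`B10Eq27AxialLog.hol_contour27` (b10: the same loop for B10 (27), `ℤ^d`, C⋆-algebra values) is a sibling reading, not needed
here; T4 NE2's `RegularTransporters*`∕`HolonomyTowerRegular` type (3.35) as per-bond SIZE hypotheses on transporter towers
(no thin-loop statement); no module states the local plaquette ⇒ thin-loop bound or the gauge-form bound.
-/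

namespace Summit.QuantumFields.BalabanUV.Beta.ThinLoopHolonomy

open Literature.MathematicalPhysics.QuantumFieldTheory.Balaban1983to89.B7Prop1Explicit
open Literature.MathematicalPhysics.QuantumFieldTheory.Balaban1983to89.B7Prop1Local
open Literature.MathematicalPhysics.QuantumFieldTheory.Balaban1983to89 (B8Ineq170.norm_mul_sub_one_le_of_norm_le_one)

variable {d : ℕ}

/-! ## §1 The thin loop of a bond through the tree contours: definition, closed word, gauge covariance, locality -/

section Group

variable {G : Type*} [Group G]

/-- **THE THIN LOOP** of the bond `⟨x, x + e_μ⟩` seen from the base point `y`: `V(Γ_{y,x})·V(x, x+e_μ)·V(Γ_{y,x+e_μ})⁻¹`,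
i.e. the bond variable in the complete axial gauge based at `y` (b07's `gaugeAct (axialFn V y) V`).  In the covariant
block averages (3.19) this is the holonomy `R_y(x)·U(b)·R_y(x+e_μ)ᵀ` multiplying the plateau in NOTE-I3 (e2).
[cite: Balaban1985BackgroundPropagators, (3.19) p.393] -/
def thinLoop (V : Site d → Fin d → G) (y x : Site d) (μ : Fin d) : G := gaugeAct (axialFn V y) V x μ

/-- Unfolding: `thinLoop V y x μ = V(Γ_{y,x})·V(x,μ)·V(Γ_{y,x+e_μ})⁻¹`. [folklore] -/
theorem thinLoop_eq (V : Site d → Fin d → G) (y x : Site d) (μ : Fin d) :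
    thinLoop V y x μ = hol V y (treeWord (x - y)) * V x μ * (hol V y (treeWord (x + e μ - y)))⁻¹ := rfl

/-- The CLOSED lattice word of the thin loop: `Γ_{y,x} ∪ ⟨x, x+e_μ⟩ ∪ (−Γ_{y,x+e_μ})`. [folklore] -/
def thinWord (y x : Site d) (μ : Fin d) : List (Letter d) :=
  treeWord (x - y) ++ [(μ, true)] ++ revWord (treeWord (x + e μ - y))

/-- The thin word is closed. [folklore] -/
theorem disp_thinWord (y x : Site d) (μ : Fin d) : disp (thinWord y x μ) = 0 := by
  simp only [thinWord, disp_append, disp_treeWord, disp_cons, disp_nil, Letter.vec_true, disp_revWord]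
  abel

/-- Its length is `|x − y|₁ + 1 + |x + e_μ − y|₁`. [folklore] -/
theorem length_thinWord (y x : Site d) (μ : Fin d) :
    (thinWord y x μ).length = l1 (x - y) + 1 + l1 (x + e μ - y) := by
  simp only [thinWord, List.length_append, length_treeWord, List.length_cons, List.length_nil, length_revWord]

/-- The thin loop IS the transport along the thin word from `y`. [folklore] -/
theorem hol_thinWord (V : Site d → Fin d → G) (y x : Site d) (μ : Fin d) :
    hol V y (thinWord y x μ) = thinLoop V y x μ := by
  have h1 : hol V (y + (x - y + e μ)) (revWord (treeWord (x + e μ - y))) = (hol V y (treeWord (x + e μ - y)))⁻¹ :=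
    hol_revWord' V _ _ (by rw [disp_treeWord]; abel)
  rw [thinWord, hol_append, hol_append, disp_append, disp_treeWord, disp_cons, disp_nil, Letter.vec_true, add_zero,
    h1, thinLoop_eq, show y + (x - y) = x by abel, hol_cons, hol_nil, mul_one, stepHol_true]

/-- **GAUGE COVARIANCE**: under a gauge transformation `u` the thin loop is conjugated by `u(y)`.
[cite: Balaban1985Averaging, (8) p.18] -/
theorem thinLoop_gaugeAct (u : Site d → G) (V : Site d → Fin d → G) (y x : Site d) (μ : Fin d) :
    thinLoop (gaugeAct u V) y x μ = u y * thinLoop V y x μ * (u y)⁻¹ := by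
  rw [← hol_thinWord, ← hol_thinWord, hol_gaugeAct_closed _ _ _ _ (disp_thinWord y x μ)]

/-- **LOCALITY**: two configurations agreeing on the bonds of a box containing `y`, `x` and `x + e_μ` have the same thin
loop — the tree contours of B5 (1.7) stay inside any coordinate box containing their endpoints.
[cite: Balaban1985Averaging, p.24] -/
theorem thinLoop_congr {lo hi : Site d} {V V' : Site d → Fin d → G} (h : AgreeOn lo hi V V') {y x : Site d} {μ : Fin d}
    (hy : InBox lo hi y) (hx : InBox lo hi x) (hxe : InBox lo hi (x + e μ)) :
    thinLoop V y x μ = thinLoop V' y x μ := by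
  rw [thinLoop_eq, thinLoop_eq, hol_treeWord_congr h y (x - y) hy (by rwa [show y + (x - y) = x by abel]),
    hol_treeWord_congr h y (x + e μ - y) hy (by rwa [show y + (x + e μ - y) = x + e μ by abel]), h x μ hx hxe]

end Group

/-! ## §2 Normed units: gauge INVARIANCE of the defect, the product bound along a word, clamped bond variables -/

section Normed

variable {𝔸 : Type*} [NormedRing 𝔸] [NormOneClass 𝔸]

/-- **THE DEFECT IS GAUGE INVARIANT**: `‖thinLoop Vᵘ − 1‖ = ‖thinLoop V − 1‖` for norm-≤-1 gauge transformations.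
[cite: Balaban1985Averaging, (45) p.24] -/
theorem norm_thinLoop_gaugeAct_sub_one {u : Site d → 𝔸ˣ} (hu : ∀ x, u x ∈ U1 𝔸) (V : Site d → Fin d → 𝔸ˣ)
    (y x : Site d) (μ : Fin d) :
    ‖((thinLoop (gaugeAct u V) y x μ : 𝔸ˣ) : 𝔸) - 1‖ = ‖((thinLoop V y x μ : 𝔸ˣ) : 𝔸) - 1‖ := by
  refine le_antisymm ?_ ?_
  · rw [thinLoop_gaugeAct, Units.val_mul, Units.val_mul]
    exact norm_units_conj_sub_one_le (hu y) _
  · have h : thinLoop V y x μ = (u y)⁻¹ * thinLoop (gaugeAct u V) y x μ * u y := by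
      rw [thinLoop_gaugeAct]; group
    rw [h, Units.val_mul, Units.val_mul]
    exact norm_units_inv_conj_sub_one_le (hu y) _

/-- **PRODUCT BOUND ALONG A WORD**: if every bond variable is a norm-≤-1 unit within `ε` of `1`, then
`‖V(Γ) − 1‖ ≤ |Γ|·ε` for every word `Γ` (`‖ab − 1‖ ≤ ‖a − 1‖ + ‖b − 1‖` for `‖a‖ ≤ 1`). [folklore] -/
theorem norm_hol_sub_one_le_length_mul {V : Site d → Fin d → 𝔸ˣ} (hV : ∀ x κ, V x κ ∈ U1 𝔸) {ε : ℝ}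
    (hε : ∀ x κ, ‖((V x κ : 𝔸ˣ) : 𝔸) - 1‖ ≤ ε) :
    ∀ (w : List (Letter d)) (x : Site d), ‖((hol V x w : 𝔸ˣ) : 𝔸) - 1‖ ≤ w.length * ε
  | [], x => by simp
  | l :: w, x => by
    rw [hol_cons, Units.val_mul, List.length_cons, Nat.cast_succ, add_mul, one_mul]
    have hstep : ‖((stepHol V x l : 𝔸ˣ) : 𝔸) - 1‖ ≤ ε := by
      obtain ⟨κ, b⟩ := l
      cases b
      · rw [stepHol_false]
        exact (norm_inv_sub_one_le (hV _ _)).trans (hε _ _)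
      · rw [stepHol_true]
        exact hε _ _
    calc _ ≤ ‖((stepHol V x l : 𝔸ˣ) : 𝔸) - 1‖ + ‖((hol V (x + l.vec) w : 𝔸ˣ) : 𝔸) - 1‖ :=
          B8Ineq170.norm_mul_sub_one_le_of_norm_le_one (stepHol_mem hV x l).1
      _ ≤ ε + w.length * ε := add_le_add hstep (norm_hol_sub_one_le_length_mul hV hε w _)
      _ = w.length * ε + ε := add_comm _ _

variable {G : Type*} [Group G]

/-- The bond variables of b07's clamped extension `π^*V`: each is `1` or a bond variable of `V` on a genuine bond of
the box. [folklore] -/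
theorem clampCfg_apply_cases {lo hi : Site d} (hlohi : ∀ i, lo i ≤ hi i) (V : Site d → Fin d → G) (x : Site d)
    (κ : Fin d) :
    clampCfg lo hi V x κ = 1 ∨
      (InBox lo hi (clamp lo hi x) ∧ InBox lo hi (clamp lo hi x + e κ) ∧
        clampCfg lo hi V x κ = V (clamp lo hi x) κ) := by
  unfold clampCfg
  by_cases h : lo κ ≤ x κ ∧ x κ < hi κ
  · right
    refine ⟨clamp_inBox hlohi x, ?_, by rw [if_pos h]⟩
    rw [← clamp_add_e_of h]
    exact clamp_inBox hlohi _
  · left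
    rw [if_neg h]

omit [NormOneClass 𝔸] in
/-- Hence: if the bond variables of `V` on the box are ε-close to `1` (`ε ≥ 0`), ALL bond variables of `π^*V` are.
[folklore] -/
theorem norm_clampCfg_sub_one_le {lo hi : Site d} (hlohi : ∀ i, lo i ≤ hi i) (V : Site d → Fin d → 𝔸ˣ) {ε : ℝ}
    (hε : 0 ≤ ε) (hV : ∀ x κ, InBox lo hi x → InBox lo hi (x + e κ) → ‖((V x κ : 𝔸ˣ) : 𝔸) - 1‖ ≤ ε)
    (x : Site d) (κ : Fin d) :
    ‖((clampCfg lo hi V x κ : 𝔸ˣ) : 𝔸) - 1‖ ≤ ε := by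
  rcases clampCfg_apply_cases hlohi V x κ with h | ⟨h1, h2, h3⟩
  · rw [h]; simpa using hε
  · rw [h3]; exact hV _ _ h1 h2

end Normed

/-! ## §3 (P) The plaquette form: ‖thin loop − 1‖ ≤ |x − y|₁ · α from the plaquettes INSIDE the box -/

section Plaquettes

variable {𝔸 : Type*} [NormedRing 𝔸] [NormOneClass 𝔸]

/-- **THIN LOOPS ARE SMALL WHERE THE PLAQUETTES ARE (gauge-invariant form)**: if `|V(∂p) − 1| ≤ α` for every unit
plaquette INSIDE a coordinate box `[lo, hi]` containing `y`, `x` and `x + e_μ`, then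
`‖V(Γ_{y,x})V(x,x+e_μ)V(Γ_{y,x+e_μ})⁻¹ − 1‖ ≤ |x − y|₁·α` — the thin loop bounds a ladder of at most `|x − y|₁`
plaquettes of the box (b07's non-abelian Stokes ladder `axial_bond_bound`, applied to the clamped extension `π^*V`
whose plaquette variables are `1` or plaquette variables of `V` inside the box). [cite: Balaban1985Averaging, pp.24–25] -/
theorem norm_thinLoop_sub_one_le_of_plaquettes {lo hi : Site d} (hlohi : ∀ i, lo i ≤ hi i)
    (V : Site d → Fin d → 𝔸ˣ) (hV : ∀ x κ, V x κ ∈ U1 𝔸) {α : ℝ} (hα : 0 ≤ α)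
    (h44 : ∀ (z : Site d) (κ ν : Fin d), κ ≠ ν → PlaqIn lo hi (z, κ, ν) →
      ‖((hol V z (plaqWord κ ν) : 𝔸ˣ) : 𝔸) - 1‖ ≤ α)
    {y x : Site d} {μ : Fin d} (hy : InBox lo hi y) (hx : InBox lo hi x) (hxe : InBox lo hi (x + e μ)) :
    ‖((thinLoop V y x μ : 𝔸ˣ) : 𝔸) - 1‖ ≤ l1 (x - y) * α := by
  set W := clampCfg lo hi V with hW
  have hWm : ∀ x κ, W x κ ∈ U1 𝔸 := clampCfg_mem hV
  have hW44 : ∀ (z : Site d) (κ ν : Fin d), κ ≠ ν → ‖((hol W z (plaqWord κ ν) : 𝔸ˣ) : 𝔸) - 1‖ ≤ α :=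
    fun z κ ν hκν => norm_hol_plaqWord_clampCfg_le hlohi V hκν hα (fun z' hz' => h44 z' κ ν hκν hz') z
  rw [thinLoop_congr (clampCfg_agree (lo := lo) (hi := hi) V).symm hy hx hxe]
  exact axial_bond_bound W hWm y hW44 hα x μ

end Plaquettes

/-! ## §4 (G) The gauge form: ‖thin loop − 1‖ ≤ (|x − y|₁ + 1 + |x + e_μ − y|₁) · ε from a small gauge on the box -/

section Gauge

variable {𝔸 : Type*} [NormedRing 𝔸] [NormOneClass 𝔸]

/-- **THIN LOOPS ARE SMALL IN A (3.35)-SHAPE CLASS**: if there is a norm-≤-1 gauge transformation `u` such that every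
bond variable of `Vᵘ` on the box `[lo, hi]` is within `ε` of `1` («there exists a gauge transformation u on □ such that
Uᵘ = e^{iηA}, |A| < …» — SHAPE of (3.35)), then for `y, x, x + e_μ` in the box
`‖V(Γ_{y,x})V(x,x+e_μ)V(Γ_{y,x+e_μ})⁻¹ − 1‖ ≤ (|x − y|₁ + 1 + |x + e_μ − y|₁)·ε`: the defect is gauge invariant, and in
the gauge `u` the thin loop is a product of that many bond variables of the box. [cite: Balaban1985BackgroundPropagators, (3.35) p.396] -/
theorem norm_thinLoop_sub_one_le_of_gauge {lo hi : Site d} (hlohi : ∀ i, lo i ≤ hi i)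
    (V : Site d → Fin d → 𝔸ˣ) (hV : ∀ x κ, V x κ ∈ U1 𝔸) {u : Site d → 𝔸ˣ} (hu : ∀ x, u x ∈ U1 𝔸) {ε : ℝ}
    (hε : 0 ≤ ε)
    (h335 : ∀ x κ, InBox lo hi x → InBox lo hi (x + e κ) → ‖((gaugeAct u V x κ : 𝔸ˣ) : 𝔸) - 1‖ ≤ ε)
    {y x : Site d} {μ : Fin d} (hy : InBox lo hi y) (hx : InBox lo hi x) (hxe : InBox lo hi (x + e μ)) :
    ‖((thinLoop V y x μ : 𝔸ˣ) : 𝔸) - 1‖ ≤ (l1 (x - y) + 1 + l1 (x + e μ - y)) * ε := by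
  set W := clampCfg lo hi (gaugeAct u V) with hW
  have hWm : ∀ x κ, W x κ ∈ U1 𝔸 := clampCfg_mem (gaugeAct_mem hV hu)
  have hWε : ∀ x κ, ‖((W x κ : 𝔸ˣ) : 𝔸) - 1‖ ≤ ε := norm_clampCfg_sub_one_le hlohi _ hε h335
  rw [← norm_thinLoop_gaugeAct_sub_one hu V y x μ,
    thinLoop_congr (clampCfg_agree (lo := lo) (hi := hi) (gaugeAct u V)).symm hy hx hxe, ← hol_thinWord]
  have h := norm_hol_sub_one_le_length_mul hWm hWε (thinWord y x μ) y
  rw [length_thinWord] at h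
  exact_mod_cast h

end Gauge

/-! ## §5 The consumer's currency: (complexified) real orthogonal matrices with the `ℓ²`-operator norm

The covariant engines of row D4 (`CoarseCoerciveCovariantEnergy`, an4-g40) carry real orthogonal fibre transporters and
measure the holonomy defect on COMPLEX fibre vectors, `‖(hol − 1)v‖ ≤ h‖v‖`.  The dictionary: push a configuration of
real orthogonal matrices through the complexification ring hom into the C⋆-algebra `Matrix Cp Cp ℂ` (ℓ²-operator norm),
where it takes values in b07's norm-≤-1 units `U1`, transports∕thin loops∕plaquettes are pushed forward letter by letter
(`hol_map`), and norm bounds are operator bounds (`norm_toLp_mulVec_le`, `norm_le_of_mulVec_le`). -/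

section MonoidHom

variable {G H : Type*} [Group G] [Group H]

/-- Transport commutes with a change of structure group (a group hom applied bondwise). [folklore] -/
theorem hol_map (φ : G →* H) (V : Site d → Fin d → G) :
    ∀ (x : Site d) (w : List (Letter d)), hol (fun z κ => φ (V z κ)) x w = φ (hol V x w)
  | x, [] => by simp
  | x, l :: w => by
    rw [hol_cons, hol_cons, map_mul, hol_map φ V (x + l.vec) w]
    congr 1
    obtain ⟨κ, b⟩ := l
    cases b
    · rw [stepHol_false, stepHol_false, map_inv]
    · rw [stepHol_true, stepHol_true]

/-- Hence thin loops are pushed forward by group homs. [folklore] -/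
theorem thinLoop_map (φ : G →* H) (V : Site d → Fin d → G) (y x : Site d) (μ : Fin d) :
    thinLoop (fun z κ => φ (V z κ)) y x μ = φ (thinLoop V y x μ) := by
  rw [thinLoop_eq, thinLoop_eq, hol_map, hol_map, map_mul, map_mul, map_inv]

end MonoidHom

section Complexified

open scoped Matrix Matrix.Norms.L2Operator

variable {Cp : Type*} [Fintype Cp] [DecidableEq Cp]

/-- The complexification ring hom `M ↦ (M_{ai} : ℂ)` of real fibre matrices (an4's `cpx`, as a bundled hom). [folklore] -/
abbrev cpxHom : Matrix Cp Cp ℝ →+* Matrix Cp Cp ℂ := Complex.ofRealHom.mapMatrix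

/-- Entries of the complexification. [folklore] -/
theorem cpxHom_apply (M : Matrix Cp Cp ℝ) (a i : Cp) : cpxHom M a i = ((M a i : ℝ) : ℂ) := rfl

/-- The conjugate transpose of a complexified real matrix is the complexified transpose. [folklore] -/
theorem conjTranspose_cpxHom (M : Matrix Cp Cp ℝ) : (cpxHom M)ᴴ = cpxHom Mᵀ := by
  ext a i
  simp [Matrix.conjTranspose_apply, Matrix.transpose_apply]

/-- A real orthogonal matrix `O` (`Oᵀ·O = 1`) as a unit of `Matrix Cp Cp ℂ` with inverse `Oᵀ`. [folklore] -/
def cpxUnit (O : Matrix Cp Cp ℝ) (hO : Oᵀ * O = 1) : (Matrix Cp Cp ℂ)ˣ :=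
  ⟨cpxHom O, cpxHom Oᵀ, by rw [← map_mul, mul_eq_one_comm.mp hO, map_one], by rw [← map_mul, hO, map_one]⟩

/-- `↑(cpxUnit O) = cpxHom O`. [folklore] -/
@[simp] theorem val_cpxUnit (O : Matrix Cp Cp ℝ) (hO : Oᵀ * O = 1) :
    ((cpxUnit O hO : (Matrix Cp Cp ℂ)ˣ) : Matrix Cp Cp ℂ) = cpxHom O := rfl

/-- `↑(cpxUnit O)⁻¹ = cpxHom Oᵀ`. [folklore] -/
@[simp] theorem val_inv_cpxUnit (O : Matrix Cp Cp ℝ) (hO : Oᵀ * O = 1) :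
    (((cpxUnit O hO)⁻¹ : (Matrix Cp Cp ℂ)ˣ) : Matrix Cp Cp ℂ) = cpxHom Oᵀ := rfl

/-- The units map of the complexification sends `cpxUnit` data bondwise: `Units.map cpxHom ⟨O, Oᵀ, …⟩ = cpxUnit O`.
Stated as the value identity a consumer rewrites with. [folklore] -/
theorem val_unitsMap_cpxHom (u : (Matrix Cp Cp ℝ)ˣ) :
    ((Units.map (cpxHom (Cp := Cp) : Matrix Cp Cp ℝ →* Matrix Cp Cp ℂ) u : (Matrix Cp Cp ℂ)ˣ) : Matrix Cp Cp ℂ) =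
      cpxHom (u : Matrix Cp Cp ℝ) := rfl

/-- In the `ℓ²`-operator norm a complexified orthogonal matrix has norm `≤ 1` (`‖C‖² = ‖CᴴC‖ = ‖1‖ ≤ 1`). [folklore] -/
theorem norm_cpxHom_le_one (O : Matrix Cp Cp ℝ) (hO : Oᵀ * O = 1) : ‖cpxHom O‖ ≤ 1 := by
  have h1 : ‖(1 : Matrix Cp Cp ℂ)‖ ≤ 1 := by
    rw [Matrix.cstar_norm_def, map_one]
    exact ContinuousLinearMap.norm_id_le
  have h : ‖cpxHom O‖ * ‖cpxHom O‖ ≤ 1 := by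
    rw [← CStarRing.norm_star_mul_self, Matrix.star_eq_conjTranspose, conjTranspose_cpxHom, ← map_mul, hO, map_one]
    exact h1
  nlinarith [norm_nonneg (cpxHom O)]

/-- Hence complexified orthogonal matrices are norm-≤-1 units (b07's `U1`). [folklore] -/
theorem cpxUnit_mem_U1 [Nonempty Cp] (O : Matrix Cp Cp ℝ) (hO : Oᵀ * O = 1) :
    cpxUnit O hO ∈ U1 (Matrix Cp Cp ℂ) := by
  refine ⟨norm_cpxHom_le_one O hO, ?_⟩
  rw [val_inv_cpxUnit]
  refine norm_cpxHom_le_one Oᵀ ?_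
  rw [Matrix.transpose_transpose]
  exact mul_eq_one_comm.mp hO

/-- NORM ⇒ OPERATOR BOUND on fibre vectors: `‖A v‖_{ℓ²} ≤ ‖A‖·‖v‖_{ℓ²}` (Mathlib's `l2_opNorm_mulVec` in the `toLp`
spelling of an4's `l2`). [folklore] -/
theorem norm_toLp_mulVec_le (A : Matrix Cp Cp ℂ) (v : Cp → ℂ) :
    ‖(WithLp.toLp 2 (A *ᵥ v) : EuclideanSpace ℂ Cp)‖ ≤ ‖A‖ * ‖(WithLp.toLp 2 v : EuclideanSpace ℂ Cp)‖ := by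
  rw [Matrix.l2_opNorm_def]
  exact ((Matrix.toEuclideanLin (𝕜 := ℂ) (m := Cp) (n := Cp)).trans LinearMap.toContinuousLinearMap A).le_opNorm
    (WithLp.toLp 2 v)

/-- OPERATOR BOUND ⇒ NORM: if `‖A v‖_{ℓ²} ≤ a·‖v‖_{ℓ²}` for all fibre vectors (`a ≥ 0`) then `‖A‖ ≤ a`. [folklore] -/
theorem norm_le_of_mulVec_le (A : Matrix Cp Cp ℂ) {a : ℝ} (ha : 0 ≤ a)
    (h : ∀ v : Cp → ℂ, ‖(WithLp.toLp 2 (A *ᵥ v) : EuclideanSpace ℂ Cp)‖ ≤ a * ‖(WithLp.toLp 2 v : EuclideanSpace ℂ Cp)‖) :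
    ‖A‖ ≤ a := by
  rw [Matrix.l2_opNorm_def]
  refine ContinuousLinearMap.opNorm_le_bound _ ha fun x => ?_
  exact h (WithLp.ofLp x)

end Complexified

/-! ## §6 Non-vacuity -/

section NonVacuity

open scoped Matrix.Norms.L2Operator

/-- The trivial configuration on `ℤ²` with values in `2 × 2` real matrices, box `[0, 3]²`: every thin loop equals `1`,
and the plaquette form gives the bound `|x − y|₁ · 0`. [folklore] -/
example (y x : Site 2) (μ : Fin 2) (hy : InBox (fun _ => 0) (fun _ => 3) y) (hx : InBox (fun _ => 0) (fun _ => 3) x)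
    (hxe : InBox (fun _ => 0) (fun _ => 3) (x + e μ)) :
    ‖((thinLoop (fun (_ : Site 2) (_ : Fin 2) => (1 : (Matrix (Fin 2) (Fin 2) ℝ)ˣ)) y x μ :
      (Matrix (Fin 2) (Fin 2) ℝ)ˣ) : Matrix (Fin 2) (Fin 2) ℝ) - 1‖ ≤ l1 (x - y) * 0 :=
  norm_thinLoop_sub_one_le_of_plaquettes (fun _ => by norm_num) _ (fun _ _ => (U1 _).one_mem) le_rfl
    (fun z κ ν _ _ => by simp [hol_plaqWord_eq]) hy hx hxe

end NonVacuity

end Summit.QuantumFields.BalabanUV.Beta.ThinLoopHolonomy
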